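import Mathlib
import Summits.Ventures.PercRepro2.TypedSplit
import Summits.Ventures.PercRepro2.OneTypedEdge
import Summits.Ventures.PercRepro2.BasePendant

/-!
# Typed-base reductions II: the leaf rules for `K₃` (blind cell PercRepro2, night-3 g2,
2026-08-24; rules (c) and (d) of `proofs/LEAD-TYPED-REDUCTION.md` §1, kernel-checked)

For the kernel `K₃` of the covariance form (HCOV) (`HCovCubic.lean`) and its state form `KB`
(`OneTypedEdge.lean`: `K₃ x y z = KB (st x) (st y) (st z)`, the state = the seven connections
among the marks), on every finite graph, every marking and every pinning:

* **`typedCount_unmarked_leaf`** (rule (c)): a typed edge `f = {l, u}` whose end `l` is a leaf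
  carrying no mark contributes the factor `C(3, τ f)`: `N_τ = C(3, τ f) · N_{τ[f := 0]}`;
* **`typedCount_pendant_b`**, **`typedCount_pendant_o`** (rule (d)): a typed edge `f = {b, u}`
  (resp. `{o, u}`) whose end is a leaf carrying exactly the mark `b` (resp. `o`) contributes the
  factor `C(2, τ f − 1)`: `N_τ = C(2, τ f − 1) · N_{τ[f := 3]}` for `τ f ≥ 1` (with `f` pinned
  open, `b` sits at `u`).

Mechanism: closing the leaf edge in a copy isolates the mark in that copy
(`st_update_pendant_b` / `st_update_pendant_o`: the state is `killB` / `killO` of the state with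
the edge open), and isolating `b` (resp. `o`) in a copy kills exactly the kernel terms whose
`b`-factor (resp. `o`-factor) sits in that copy (`KB_killB`, `KB_killO`: `KB = KBy + KBz`,
`KB = KOx + KOy + KOz`); the `Bool³` sums `sum_bool3_choose` / `sum_bool3_pend` /
`sum_bool3_pend3` give the binomial multiplicities. Not a rule: `a₃` (two `a₃`-factors in one
term), `a₁`, `a₂` (in every term).
-/

namespace Summit.Ventures.PercRepro2

namespace CovForm

namespace TypedRed

open OneTyped

/-! ## States at a leaf edge -/

section States

open Classical

variable {V : Type*} {E : Type*} [Fintype E] [DecidableEq E] {R : Type*} [Field R]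

/-- The state with the mark `b` isolated (`b ∉ C(a₁) ∪ C(a₂)`). -/
def killB (s : St) : St := (s.1, s.2.1, s.2.2.1, false, false, s.2.2.2.2.2.1, s.2.2.2.2.2.2)

/-- The state with the mark `o` isolated (`o ∉ C(a₁) ∪ C(a₂)`). -/
def killO (s : St) : St := (s.1, false, false, s.2.2.2.1, s.2.2.2.2.1, s.2.2.2.2.2.1, s.2.2.2.2.2.2)

/-- The four kernel terms whose `b`-factor sits in the second copy. -/
def KBy (x y z : St) : ℤ :=
  - pdB x * ((qB y * sigB y.Lb y.Hb) * (qB z * sigB z.Lo z.Ho))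
  - (pdB x * uB x.Lo x.Ho) * ((qB y * sigB y.Lb y.Hb) * (qB z * sigB z.L3 z.H3))
  + pdB x * ((qB y * sigB y.Lb y.Hb) * (qB z * (sigB z.L3 z.H3 * uB z.Lo z.Ho)))
  + qB x * ((pdB y * uB y.Lb y.Hb) * (pdB z * uB z.Lo z.Ho))

/-- The four kernel terms whose `b`-factor sits in the third copy. -/
def KBz (x y z : St) : ℤ :=
  pdB x * (qB y * (qB z * (sigB z.Lo z.Ho * sigB z.Lb z.Hb)))
  + qB x * ((pdB y * uB y.Lo y.Ho) * (qB z * (sigB z.L3 z.H3 * sigB z.Lb z.Hb)))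
  - pdB x * (qB y * (qB z * (sigB z.L3 z.H3 * (uB z.Lo z.Ho * sigB z.Lb z.Hb))))
  - pdB x * (qB y * (pdB z * (uB z.Lo z.Ho * uB z.Lb z.Hb)))

/-- The kernel term whose `o`-factor sits in the first copy. -/
def KOx (x y z : St) : ℤ :=
  - (pdB x * uB x.Lo x.Ho) * ((qB y * sigB y.Lb y.Hb) * (qB z * sigB z.L3 z.H3))

/-- The kernel term whose `o`-factor sits in the second copy. -/
def KOy (x y z : St) : ℤ :=
  qB x * ((pdB y * uB y.Lo y.Ho) * (qB z * (sigB z.L3 z.H3 * sigB z.Lb z.Hb)))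

/-- The six kernel terms whose `o`-factor sits in the third copy. -/
def KOz (x y z : St) : ℤ :=
  pdB x * (qB y * (qB z * (sigB z.Lo z.Ho * sigB z.Lb z.Hb)))
  - pdB x * (qB y * (qB z * (sigB z.L3 z.H3 * (uB z.Lo z.Ho * sigB z.Lb z.Hb))))
  - pdB x * ((qB y * sigB y.Lb y.Hb) * (qB z * sigB z.Lo z.Ho))
  + pdB x * ((qB y * sigB y.Lb y.Hb) * (qB z * (sigB z.L3 z.H3 * uB z.Lo z.Ho)))
  - pdB x * (qB y * (pdB z * (uB z.Lo z.Ho * uB z.Lb z.Hb)))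
  + qB x * ((pdB y * uB y.Lb y.Hb) * (pdB z * uB z.Lo z.Ho))

/-- `killB` keeps `q'`. -/
@[simp] lemma killB_q' (s : St) : (killB s).q' = s.q' := rfl
/-- `killB` keeps `Lo`. -/
@[simp] lemma killB_Lo (s : St) : (killB s).Lo = s.Lo := rfl
/-- `killB` keeps `Ho`. -/
@[simp] lemma killB_Ho (s : St) : (killB s).Ho = s.Ho := rfl
/-- `killB` isolates `b` from `C(a₁)`. -/
@[simp] lemma killB_Lb (s : St) : (killB s).Lb = false := rfl
/-- `killB` isolates `b` from `C(a₂)`. -/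
@[simp] lemma killB_Hb (s : St) : (killB s).Hb = false := rfl
/-- `killB` keeps `L3`. -/
@[simp] lemma killB_L3 (s : St) : (killB s).L3 = s.L3 := rfl
/-- `killB` keeps `H3`. -/
@[simp] lemma killB_H3 (s : St) : (killB s).H3 = s.H3 := rfl
/-- `killO` keeps `q'`. -/
@[simp] lemma killO_q' (s : St) : (killO s).q' = s.q' := rfl
/-- `killO` isolates `o` from `C(a₁)`. -/
@[simp] lemma killO_Lo (s : St) : (killO s).Lo = false := rfl
/-- `killO` isolates `o` from `C(a₂)`. -/
@[simp] lemma killO_Ho (s : St) : (killO s).Ho = false := rfl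
/-- `killO` keeps `Lb`. -/
@[simp] lemma killO_Lb (s : St) : (killO s).Lb = s.Lb := rfl
/-- `killO` keeps `Hb`. -/
@[simp] lemma killO_Hb (s : St) : (killO s).Hb = s.Hb := rfl
/-- `killO` keeps `L3`. -/
@[simp] lemma killO_L3 (s : St) : (killO s).L3 = s.L3 := rfl
/-- `killO` keeps `H3`. -/
@[simp] lemma killO_H3 (s : St) : (killO s).H3 = s.H3 := rfl
/-- `σ` of an isolated mark is `0`. -/
lemma sigB_ff : sigB false false = 0 := rfl
/-- `1_U` of an isolated mark is `0`. -/
lemma uB_ff : uB false false = 0 := rfl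
/-- `pdB` sees only `q', L3, H3`. -/
lemma pdB_killB (s : St) : pdB (killB s) = pdB s := rfl
/-- `pdB` sees only `q', L3, H3`. -/
lemma pdB_killO (s : St) : pdB (killO s) = pdB s := rfl
/-- `qB` sees only `q'`. -/
lemma qB_killB (s : St) : qB (killB s) = qB s := rfl
/-- `qB` sees only `q'`. -/
lemma qB_killO (s : St) : qB (killO s) = qB s := rfl

/-- `KB = KBy + KBz`. -/
lemma KB_eq_KBy_add_KBz (x y z : St) : KB x y z = KBy x y z + KBz x y z := by
  unfold KB KBy KBz; ring

/-- `KB = KOx + KOy + KOz`. -/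
lemma KB_eq_KOx_add (x y z : St) : KB x y z = KOx x y z + KOy x y z + KOz x y z := by
  unfold KB KOx KOy KOz; ring

/-- **The pendant-`b` identity on states**: isolating `b` in a copy kills exactly the terms whose
`b`-factor sits in that copy. -/
lemma KB_killB (a b c : Bool) (x y z : St) :
    KB (cond a x (killB x)) (cond b y (killB y)) (cond c z (killB z)) =
      (if b then KBy x y z else 0) + (if c then KBz x y z else 0) := by
  cases a <;> cases b <;> cases c <;>
    simp only [cond_true, cond_false, KB, KBy, KBz, killB_Lo, killB_Ho, killB_Lb,
      killB_Hb, killB_L3, killB_H3, sigB_ff, uB_ff, pdB_killB, qB_killB, Bool.false_eq_true,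
      if_false, if_true] <;> ring

/-- **The pendant-`o` identity on states**. -/
lemma KB_killO (a b c : Bool) (x y z : St) :
    KB (cond a x (killO x)) (cond b y (killO y)) (cond c z (killO z)) =
      (if a then KOx x y z else 0) + (if b then KOy x y z else 0) + (if c then KOz x y z else 0) := by
  cases a <;> cases b <;> cases c <;>
    simp only [cond_true, cond_false, KB, KOx, KOy, KOz, killO_Lo, killO_Ho, killO_Lb,
      killO_Hb, killO_L3, killO_H3, sigB_ff, uB_ff, pdB_killO, qB_killO, Bool.false_eq_true,
      if_false, if_true] <;> ring

variable (ends : E → Sym2 V) (o a₁ a₂ a₃ b : V)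

omit [Fintype E] in
/-- The state is unchanged by the state of a leaf edge at an unmarked leaf. -/
lemma st_update_unmarked_leaf {f : E} {l u : V} (hf : ends f = s(l, u))
    (hleaf : ∀ e, l ∈ ends e → e = f) (hlu : l ≠ u) (hlo : l ≠ o) (hl1 : l ≠ a₁) (hl2 : l ≠ a₂)
    (hl3 : l ≠ a₃) (hlb : l ≠ b) (x : Config E) (c : Bool) :
    st ends o a₁ a₂ a₃ b (Function.update x f c) = st ends o a₁ a₂ a₃ b x := by
  unfold st
  simp only [Prod.mk.injEq]
  exact ⟨decide_eq_decide.mpr (conn_update_leaf_iff hf hleaf hlu c hl2.symm hl1.symm),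
    decide_eq_decide.mpr (conn_update_leaf_iff hf hleaf hlu c hl1.symm hlo.symm),
    decide_eq_decide.mpr (conn_update_leaf_iff hf hleaf hlu c hl2.symm hlo.symm),
    decide_eq_decide.mpr (conn_update_leaf_iff hf hleaf hlu c hl1.symm hlb.symm),
    decide_eq_decide.mpr (conn_update_leaf_iff hf hleaf hlu c hl2.symm hlb.symm),
    decide_eq_decide.mpr (conn_update_leaf_iff hf hleaf hlu c hl1.symm hl3.symm),
    decide_eq_decide.mpr (conn_update_leaf_iff hf hleaf hlu c hl2.symm hl3.symm)⟩

omit [Fintype E] in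
/-- At a pendant `b` (a leaf carrying exactly the mark `b`), closing the leaf edge isolates `b`. -/
lemma st_update_pendant_b {f : E} {u : V} (hf : ends f = s(b, u))
    (hleaf : ∀ e, b ∈ ends e → e = f) (hbu : b ≠ u) (hbo : b ≠ o) (hb1 : b ≠ a₁) (hb2 : b ≠ a₂)
    (hb3 : b ≠ a₃) (x : Config E) :
    st ends o a₁ a₂ a₃ b (Function.update x f false) =
      killB (st ends o a₁ a₂ a₃ b (Function.update x f true)) := by
  unfold st killB
  simp only [Prod.mk.injEq]
  have hF : Function.update x f false f = false := Function.update_self f false x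
  refine ⟨?_, ?_, ?_, ?_, ?_, ?_, ?_⟩
  · exact decide_eq_decide.mpr ((conn_update_leaf_iff hf hleaf hbu false hb2.symm hb1.symm).trans
      (conn_update_leaf_iff hf hleaf hbu true hb2.symm hb1.symm).symm)
  · exact decide_eq_decide.mpr ((conn_update_leaf_iff hf hleaf hbu false hb1.symm hbo.symm).trans
      (conn_update_leaf_iff hf hleaf hbu true hb1.symm hbo.symm).symm)
  · exact decide_eq_decide.mpr ((conn_update_leaf_iff hf hleaf hbu false hb2.symm hbo.symm).trans
      (conn_update_leaf_iff hf hleaf hbu true hb2.symm hbo.symm).symm)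
  · exact decide_eq_false fun h => hb1 (conn_leaf_closed hf hleaf hbu hF (conn_symm h)).symm
  · exact decide_eq_false fun h => hb2 (conn_leaf_closed hf hleaf hbu hF (conn_symm h)).symm
  · exact decide_eq_decide.mpr ((conn_update_leaf_iff hf hleaf hbu false hb1.symm hb3.symm).trans
      (conn_update_leaf_iff hf hleaf hbu true hb1.symm hb3.symm).symm)
  · exact decide_eq_decide.mpr ((conn_update_leaf_iff hf hleaf hbu false hb2.symm hb3.symm).trans
      (conn_update_leaf_iff hf hleaf hbu true hb2.symm hb3.symm).symm)

omit [Fintype E] in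
/-- At a pendant `o` (a leaf carrying exactly the mark `o`), closing the leaf edge isolates `o`. -/
lemma st_update_pendant_o {f : E} {u : V} (hf : ends f = s(o, u))
    (hleaf : ∀ e, o ∈ ends e → e = f) (hou : o ≠ u) (ho1 : o ≠ a₁) (ho2 : o ≠ a₂)
    (ho3 : o ≠ a₃) (hob : o ≠ b) (x : Config E) :
    st ends o a₁ a₂ a₃ b (Function.update x f false) =
      killO (st ends o a₁ a₂ a₃ b (Function.update x f true)) := by
  unfold st killO
  simp only [Prod.mk.injEq]
  have hF : Function.update x f false f = false := Function.update_self f false x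
  refine ⟨?_, ?_, ?_, ?_, ?_, ?_, ?_⟩
  · exact decide_eq_decide.mpr ((conn_update_leaf_iff hf hleaf hou false ho2.symm ho1.symm).trans
      (conn_update_leaf_iff hf hleaf hou true ho2.symm ho1.symm).symm)
  · exact decide_eq_false fun h => ho1 (conn_leaf_closed hf hleaf hou hF (conn_symm h)).symm
  · exact decide_eq_false fun h => ho2 (conn_leaf_closed hf hleaf hou hF (conn_symm h)).symm
  · exact decide_eq_decide.mpr ((conn_update_leaf_iff hf hleaf hou false ho1.symm hob.symm).trans
      (conn_update_leaf_iff hf hleaf hou true ho1.symm hob.symm).symm)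
  · exact decide_eq_decide.mpr ((conn_update_leaf_iff hf hleaf hou false ho2.symm hob.symm).trans
      (conn_update_leaf_iff hf hleaf hou true ho2.symm hob.symm).symm)
  · exact decide_eq_decide.mpr ((conn_update_leaf_iff hf hleaf hou false ho1.symm ho3.symm).trans
      (conn_update_leaf_iff hf hleaf hou true ho1.symm ho3.symm).symm)
  · exact decide_eq_decide.mpr ((conn_update_leaf_iff hf hleaf hou false ho2.symm ho3.symm).trans
      (conn_update_leaf_iff hf hleaf hou true ho2.symm ho3.symm).symm)

end States

/-! ## The three Bool³ sums -/

section Sums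

variable {R : Type*} [CommRing R]

/-- `Σ_{(a,b,c) ∈ Bool³, a+b+c = k} T = C(3,k) · T`. -/
lemma sum_bool3_choose (k : ℕ) (T : R) :
    (∑ a : Bool, ∑ b : Bool, ∑ c : Bool, if a.toNat + b.toNat + c.toNat = k then T else 0) =
      (Nat.choose 3 k : R) * T := by
  simp only [Fintype.sum_bool, Bool.toNat_true, Bool.toNat_false]
  rcases k with _ | _ | _ | _ | k
  · norm_num
  · norm_num [Nat.choose]
    ring
  · norm_num [Nat.choose]
    ring
  · norm_num [Nat.choose]
  · rw [Nat.choose_eq_zero_of_lt (by omega)]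
    norm_num

/-- `Σ_{(a,b,c) ∈ Bool³, a+b+c = k} ([b] Y + [c] Z) = C(2,k−1) · (Y + Z)` for `k ≥ 1`. -/
lemma sum_bool3_pend (k : ℕ) (hk : 1 ≤ k) (Y Z : R) :
    (∑ a : Bool, ∑ b : Bool, ∑ c : Bool, if a.toNat + b.toNat + c.toNat = k then
        ((if b then Y else 0) + (if c then Z else 0)) else 0) =
      (Nat.choose 2 (k - 1) : R) * (Y + Z) := by
  simp only [Fintype.sum_bool, Bool.toNat_true, Bool.toNat_false, Bool.false_eq_true, if_false,
    if_true]
  rcases k with _ | _ | _ | _ | k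
  · omega
  · norm_num [Nat.choose]
  · norm_num [Nat.choose]
    ring
  · norm_num [Nat.choose]
  · rw [show k + 1 + 1 + 1 + 1 - 1 = k + 3 by omega, Nat.choose_eq_zero_of_lt (by omega)]
    norm_num

/-- `Σ_{(a,b,c) ∈ Bool³, a+b+c = k} ([a] X + [b] Y + [c] Z) = C(2,k−1) · (X + Y + Z)` for `k ≥ 1`. -/
lemma sum_bool3_pend3 (k : ℕ) (hk : 1 ≤ k) (X Y Z : R) :
    (∑ a : Bool, ∑ b : Bool, ∑ c : Bool, if a.toNat + b.toNat + c.toNat = k then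
        ((if a then X else 0) + (if b then Y else 0) + (if c then Z else 0)) else 0) =
      (Nat.choose 2 (k - 1) : R) * (X + Y + Z) := by
  simp only [Fintype.sum_bool, Bool.toNat_true, Bool.toNat_false, Bool.false_eq_true, if_false,
    if_true]
  rcases k with _ | _ | _ | _ | k
  · omega
  · norm_num [Nat.choose]
    ring
  · norm_num [Nat.choose]
    ring
  · norm_num [Nat.choose]
  · rw [show k + 1 + 1 + 1 + 1 - 1 = k + 3 by omega, Nat.choose_eq_zero_of_lt (by omega)]
    norm_num

end Sums

/-! ## The reduction rules for `K₃` -/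

section Rules

variable {V : Type*} {E : Type*} [Fintype E] [DecidableEq E] {R : Type*} [Field R]
variable (ends : E → Sym2 V) (o a₁ a₂ a₃ b : V)

/-- **Unmarked leaf (rule (c))**: a typed edge `f = {l, u}` whose end `l` is a leaf carrying no
mark contributes the factor `C(3, τ f)`: the count is `C(3, τ f)` times the count with `f` of
type `0` (pinned closed). -/
theorem typedCount_unmarked_leaf {f : E} {l u : V} (hf : ends f = s(l, u))
    (hleaf : ∀ e, l ∈ ends e → e = f) (hlu : l ≠ u) (hlo : l ≠ o) (hl1 : l ≠ a₁) (hl2 : l ≠ a₂)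
    (hl3 : l ≠ a₃) (hlb : l ≠ b) (F : Finset E) (hfF : f ∈ F) (z : Config E) (τ : E → ℕ) :
    typedCount F z τ (K3 ends o a₁ a₂ a₃ b : Config E → Config E → Config E → R) =
      (Nat.choose 3 (τ f) : R) *
        typedCount F z (Function.update τ f 0) (K3 ends o a₁ a₂ a₃ b) := by
  have hinv : ∀ (p q r : Bool), typedCount (F.erase f) (Function.update z f false) τ
      (fun x y w => (K3 ends o a₁ a₂ a₃ b (Function.update x f p) (Function.update y f q)
        (Function.update w f r) : R)) =
      typedCount (F.erase f) (Function.update z f false) τ (K3 ends o a₁ a₂ a₃ b) := by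
    intro p q r
    refine typedCount_congr_K _ _ _ fun x y w => ?_
    rw [K3_eq_KB, K3_eq_KB,
      st_update_unmarked_leaf ends o a₁ a₂ a₃ b hf hleaf hlu hlo hl1 hl2 hl3 hlb x p,
      st_update_unmarked_leaf ends o a₁ a₂ a₃ b hf hleaf hlu hlo hl1 hl2 hl3 hlb y q,
      st_update_unmarked_leaf ends o a₁ a₂ a₃ b hf hleaf hlu hlo hl1 hl2 hl3 hlb w r]
  rw [typedCount_split F f hfF, typedCount_split_zero F f hfF, hinv]
  simp only [hinv]
  exact sum_bool3_choose (τ f) _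

/-- **Pendant `b` (rule (d))**: a typed edge `f = {b, u}` whose end `b` is a leaf carrying exactly
the mark `b` contributes the factor `C(2, τ f − 1)`: the count is `C(2, τ f − 1)` times the count
with `f` of type `3` (pinned open, i.e. `b := u`). -/
theorem typedCount_pendant_b {f : E} {u : V} (hf : ends f = s(b, u))
    (hleaf : ∀ e, b ∈ ends e → e = f) (hbu : b ≠ u) (hbo : b ≠ o) (hb1 : b ≠ a₁) (hb2 : b ≠ a₂)
    (hb3 : b ≠ a₃) (F : Finset E) (hfF : f ∈ F) (z : Config E) (τ : E → ℕ) (hτ : 1 ≤ τ f) :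
    typedCount F z τ (K3 ends o a₁ a₂ a₃ b : Config E → Config E → Config E → R) =
      (Nat.choose 2 (τ f - 1) : R) *
        typedCount F z (Function.update τ f 3) (K3 ends o a₁ a₂ a₃ b) := by
  set S := st ends o a₁ a₂ a₃ b with hS
  set Y : R := typedCount (F.erase f) (Function.update z f false) τ
    (fun x y w => ((KBy (S (Function.update x f true)) (S (Function.update y f true))
      (S (Function.update w f true)) : ℤ) : R)) with hY
  set Z : R := typedCount (F.erase f) (Function.update z f false) τ
    (fun x y w => ((KBz (S (Function.update x f true)) (S (Function.update y f true))
      (S (Function.update w f true)) : ℤ) : R)) with hZ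
  have hst : ∀ (x : Config E) (p : Bool), S (Function.update x f p) =
      cond p (S (Function.update x f true)) (killB (S (Function.update x f true))) := by
    intro x p
    cases p
    · exact st_update_pendant_b ends o a₁ a₂ a₃ b hf hleaf hbu hbo hb1 hb2 hb3 x
    · rfl
  have hsplit : ∀ (p q r : Bool), typedCount (F.erase f) (Function.update z f false) τ
      (fun x y w => (K3 ends o a₁ a₂ a₃ b (Function.update x f p) (Function.update y f q)
        (Function.update w f r) : R)) = (if q then Y else 0) + (if r then Z else 0) := by
    intro p q r
    rw [hY, hZ, ← typedCount_ite, ← typedCount_ite, ← typedCount_add]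
    refine typedCount_congr_K _ _ _ fun x y w => ?_
    rw [K3_eq_KB, ← hS, hst x p, hst y q, hst w r, KB_killB]
    push_cast
    cases q <;> cases r <;> simp
  rw [typedCount_split F f hfF]
  simp only [hsplit]
  rw [sum_bool3_pend (τ f) hτ Y Z]
  congr 1
  rw [typedCount_split_three F f hfF, hY, hZ, ← typedCount_add]
  refine typedCount_congr_K _ _ _ fun x y w => ?_
  rw [K3_eq_KB, ← hS, KB_eq_KBy_add_KBz]
  push_cast
  rfl

/-- **Pendant `o` (rule (d))**: a typed edge `f = {o, u}` whose end `o` is a leaf carrying exactly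
the mark `o` contributes the factor `C(2, τ f − 1)`: the count is `C(2, τ f − 1)` times the count
with `f` of type `3` (pinned open, i.e. `o := u`). -/
theorem typedCount_pendant_o {f : E} {u : V} (hf : ends f = s(o, u))
    (hleaf : ∀ e, o ∈ ends e → e = f) (hou : o ≠ u) (ho1 : o ≠ a₁) (ho2 : o ≠ a₂) (ho3 : o ≠ a₃)
    (hob : o ≠ b) (F : Finset E) (hfF : f ∈ F) (z : Config E) (τ : E → ℕ) (hτ : 1 ≤ τ f) :
    typedCount F z τ (K3 ends o a₁ a₂ a₃ b : Config E → Config E → Config E → R) =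
      (Nat.choose 2 (τ f - 1) : R) *
        typedCount F z (Function.update τ f 3) (K3 ends o a₁ a₂ a₃ b) := by
  set S := st ends o a₁ a₂ a₃ b with hS
  set X : R := typedCount (F.erase f) (Function.update z f false) τ
    (fun x y w => ((KOx (S (Function.update x f true)) (S (Function.update y f true))
      (S (Function.update w f true)) : ℤ) : R)) with hX
  set Y : R := typedCount (F.erase f) (Function.update z f false) τ
    (fun x y w => ((KOy (S (Function.update x f true)) (S (Function.update y f true))
      (S (Function.update w f true)) : ℤ) : R)) with hY
  set Z : R := typedCount (F.erase f) (Function.update z f false) τ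
    (fun x y w => ((KOz (S (Function.update x f true)) (S (Function.update y f true))
      (S (Function.update w f true)) : ℤ) : R)) with hZ
  have hst : ∀ (x : Config E) (p : Bool), S (Function.update x f p) =
      cond p (S (Function.update x f true)) (killO (S (Function.update x f true))) := by
    intro x p
    cases p
    · exact st_update_pendant_o ends o a₁ a₂ a₃ b hf hleaf hou ho1 ho2 ho3 hob x
    · rfl
  have hsplit : ∀ (p q r : Bool), typedCount (F.erase f) (Function.update z f false) τ
      (fun x y w => (K3 ends o a₁ a₂ a₃ b (Function.update x f p) (Function.update y f q)
        (Function.update w f r) : R)) =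
      (if p then X else 0) + (if q then Y else 0) + (if r then Z else 0) := by
    intro p q r
    rw [hX, hY, hZ, ← typedCount_ite, ← typedCount_ite, ← typedCount_ite, ← typedCount_add,
      ← typedCount_add]
    refine typedCount_congr_K _ _ _ fun x y w => ?_
    rw [K3_eq_KB, ← hS, hst x p, hst y q, hst w r, KB_killO]
    push_cast
    cases p <;> cases q <;> cases r <;> simp
  rw [typedCount_split F f hfF]
  simp only [hsplit]
  rw [sum_bool3_pend3 (τ f) hτ X Y Z]
  congr 1
  rw [typedCount_split_three F f hfF, hX, hY, hZ, ← typedCount_add, ← typedCount_add]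
  refine typedCount_congr_K _ _ _ fun x y w => ?_
  rw [K3_eq_KB, ← hS, KB_eq_KOx_add]
  push_cast
  rfl

end Rules

end TypedRed

end CovForm

end Summit.Ventures.PercRepro2
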